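import Mathlib
import Literature.LinearAlgebra.GMSPermanentalRankSubspace
import Literature.LinearAlgebra.GMSPermanentalRankSubspaceHolds
import Summits.ValiantsHypothesis.ValiantsHypothesis.Theses.GrenetZeon
import Summits.ValiantsHypothesis.ValiantsHypothesis.Theorems.GrenetZeonDualUnipotentThreeHalvesPermRankOfLineFlat
import Summits.ValiantsHypothesis.ValiantsHypothesis.Theorems.GrenetZeonTwoDimCoefficientsDefs
import Summits.ValiantsHypothesis.ValiantsHypothesis.Theorems.GrenetZeonTwoDimCoefficientsDualUnipotentNormalForm
import Summits.ValiantsHypothesis.ValiantsHypothesis.Theorems.GrenetZeonTwoDimCoefficientsDualUnipotentTriangular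

/-!
# Line `slow_planes` for the crux `GrenetZeon.DualUnipotentThreeHalves` (stmt-ValiantsHypothesis-24318)

val-idea-9 g2 (negation lens), successor of the dead line `thin_wild` (killed by the fat-long-wild
family `L_k = S⊗M_k + R⊗ℂI + E₂₃⊗𝔫_k`, crit-3 VERDICT #9).

LEVER (new, per-specific): a SLOW PLANE.  For a direction space `K ≤ Mat_n(ℂ)` and an affine
nilpotent pencil `N`, let `k` bound the `s`-degree of the entries of `N(x+sv)^{n-1}` uniformly in
the base point `x` and in `v ∈ K`.  If `per_n = tr(N^{n-1} M)` then `per_n` has `s`-degree `≤ k+1`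
along every such line, hence (base points = partial permutation matrices) every `v ∈ K` has
permanental rank `≤ k+1`, hence `dim K ≤ (k+1)·n` by GUTERMAN–MESHULAM–SPIRIDONOV 2023
(Israel J. Math., arXiv:2212.11193, Cor. 1.6: a space of matrices of permanental rank ≤ k has
dimension ≤ kn; sharp, via the Combinatorial Nullstellensatz).  This is the SHARP flat profile
(constant 1, every order k ≤ n-1); the landed LEMMA_k (`finrank_le_of_iterD_perPoly_eq_zero`)
has constant 2 and is vacuous at `k ≈ n/2`, which is exactly where wild constituents live:
the `L_k` pencil is slow of speed ½ along the hyperplane `{c = 0}` (every long power is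
`X(cT)^{j-1}Y ⊕ (cT)^j`), so `k ≈ n/2 + 1` with `codim K = 1`, and `(k+1)·n < n² − 1` — the
`L_k` carrier is impossible at every width.  Graded chains of width `m` are slow along the space
killing the bands of width `≤ √n` (`codim ≈ m√n`, `k ≈ m/√n`), which is a slow plane iff
`m ≲ n^{3/2}/2`: the 3/2 exponent is the graded case of the same count.

STUBS (registered targets):
* `stub_permRank_of_lineFlat` — S1, per-specific, size M: line-flat of order k ⇒ permanental
  rank ≤ k on K (Laplace expansion of `per(x+sv)` at a complementary partial permutation matrix).
* `stub_gms` — S2, LITERATURE THEOREM to formalise (GMS 2023 Cor. 1.6; Mathlib has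
  `MvPolynomial.combinatorial_nullstellensatz_exists_eval_nonzero`), size L.
* `stub_slowPlane` — S3 = THE per-agnostic CRUX `SlowPlane`: every affine nilpotent pencil of
  width `m`, `C₀ m² < n³`, has a slow plane: `K`, `k` with the uniform degree bound and
  `(k+1)·n < dim K`.  Stated as exactly the property the count consumes (no (dim, index) proxy).
  Pre-checked TRUE on: the `L_k` pencils (n ≥ 5), their E₁₂/E₂₃ and E₂₃⊗𝒩 extensions and the
  bi-commutant fattening B(a,b) (speed ½ along `{C = 0}`), MOR `F_k` (index 3: trivial),
  generic graded chains of width `< n^{3/2}/2`, towers of MOR blocks (chunk-freezing), block-scalar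
  towers.  Why it might fail: a nilpotent pencil of width `o(n^{3/2})` whose `(n-1)`-st power keeps
  `s`-degree `≥ n-1-o(n)` along every subspace of codimension `o(n²)` ("bottleneck-free wild pencil")
  — no such family is known; finding one kills the whole flat programme for 24318 (informative).

COMPOSITION (sorry-free): `dualUnipotentThreeHalves_of : PermRankOfLineFlat → GMSBound → SlowPlane →
GrenetZeon.DualUnipotentThreeHalves`.

VP ≠ VNP is not moved by this line; GrenetZeon / 24318 is a restricted-model rung.
-/

noncomputable section

namespace Summit.ValiantsHypothesis.ValiantsHypothesis.Cruxes.DualUnipotentThreeHalves.SlowPlanes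

open MvPolynomial Matrix
open scoped BigOperators
open Literature.Computability.AlgebraicComplexity
open Summit.ValiantsHypothesis.ValiantsHypothesis.Cruxes.TwoDimCoefficients.DimTwoCases
open Summit.ValiantsHypothesis.ValiantsHypothesis.Theses.GrenetZeon (DualUnipotentThreeHalves)

/-! ## The line substitution `x + s·v` (one direction variable `X 0`; same shape as `LevelFlat`) -/

/-- The substitution `X_c ↦ x_c + v_c · s` into one-variable polynomials (`s = X 0`). -/
def lineSubst {σ : Type*} (x v : σ → ℂ) : MvPolynomial σ ℂ →ₐ[ℂ] MvPolynomial (Fin 1) ℂ :=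
  aeval fun c => (C (x c) + ∑ t : Fin 1, C (v c) * X t : MvPolynomial (Fin 1) ℂ)

theorem lineSubst_eq {σ : Type*} (x v : σ → ℂ) :
    lineSubst x v = aeval fun c => (C (x c) + ∑ t : Fin (0 + 1), C ((fun _ : Fin (0 + 1) => v) t c) * X t :
      MvPolynomial (Fin (0 + 1)) ℂ) := rfl

/-- Affine entries stay affine along a line. -/
theorem totalDegree_lineSubst_le_one {σ : Type*} [Fintype σ] (x v : σ → ℂ) {g : MvPolynomial σ ℂ}
    (hg : g.totalDegree ≤ 1) : (lineSubst x v g).totalDegree ≤ 1 := by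
  rw [lineSubst_eq]
  exact totalDegree_aeval_line_le_one x (fun _ : Fin (0 + 1) => v) hg

/-! ## Per-specific side -/

/-- `v` has permanental rank `≤ k`: all its `(k+1) × (k+1)` subpermanents vanish. -/
def PermRankLE (n k : ℕ) (v : Fin n × Fin n → ℂ) : Prop :=
  ∀ (r c : Fin (k + 1) ↪ Fin n), (Matrix.of fun i j => v (r i, c j)).permanent = 0

/-- `K` is LINE-FLAT of order `k` for `per_n`: along every line `x + s v`, `v ∈ K`, from EVERY base
point `x`, the permanent has `s`-degree `≤ k`. -/
def LineFlat (n k : ℕ) (K : Submodule ℂ (Fin n × Fin n → ℂ)) : Prop :=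
  ∀ x v : Fin n × Fin n → ℂ, v ∈ K → (lineSubst x v (perPoly (Fin n) ℂ)).totalDegree ≤ k

/-- **S1 (per-specific, size M).** Line-flat of order `k` ⇒ permanental rank `≤ k` on `K`.
Proof sketch: for `v ∈ K` and a `(k+1)`-minor `(R, C)` take `x` = a partial permutation matrix on
`Rᶜ × Cᶜ`; in `per(x + s v) = Σ_{I,J} s^{|I|} per(v[I,J]) per(x[Iᶜ,Jᶜ])` the coefficient of
`s^{k+1}` is exactly `per(v[R,C])`. [folklore; Laplace-type expansion of `per(A+B)`] -/
def PermRankOfLineFlat : Prop :=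
  ∀ (n k : ℕ) (K : Submodule ℂ (Fin n × Fin n → ℂ)), LineFlat n k K → ∀ v ∈ K, PermRankLE n k v

/-- **S2 (literature theorem, to formalise; size L).** GUTERMAN–MESHULAM–SPIRIDONOV 2023, Cor. 1.6
(arXiv:2212.11193, Israel J. Math. doi:10.1007/s11856-023-2508-6; any field): a linear space of
`n × n` matrices all of permanental rank `≤ k` has dimension `≤ k·n` (sharp: `k` rows / `k` columns;
the permanental Dieudonné–Flanders–Meshulam theorem).  Proof in print via Alon's Combinatorial
Nullstellensatz (Mathlib: `MvPolynomial.combinatorial_nullstellensatz_exists_eval_nonzero`). -/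
def GMSBound : Prop :=
  ∀ (n k : ℕ) (K : Submodule ℂ (Fin n × Fin n → ℂ)), (∀ v ∈ K, PermRankLE n k v) → Module.finrank ℂ K ≤ k * n

/-! ## Per-agnostic side: THE crux of the line -/

/-- **S3 — SLOW PLANE (per-agnostic crux).**  Every affine nilpotent `m × m` pencil over `Mat_n(ℂ)`
with `C₀·m² < n³` admits a direction space `K` and an order `k` such that the entries of
`N(x + s v)^{n-1}` have `s`-degree `≤ k` uniformly in `x` and `v ∈ K`, while `(k+1)·n < dim K`.
TRUE on every family in the wild census (L_k: `K = {c = 0}`, `k ≈ n/2+1`; graded width `m`: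
band-killing, `codim ≈ m√n`, `k ≈ m/√n`; MOR `F_k`: `N^{n-1} = 0`).  Why it might fail: a
bottleneck-free wild pencil of width `o(n^{3/2})` (unknown). [this line; MOR 1991 §5; crit-3 #9] -/
def SlowPlane : Prop :=
  ∃ C₀ n₀ : ℕ, ∀ n ≥ n₀, ∀ m : ℕ, C₀ * m ^ 2 < n ^ 3 → ∀ N : AffMat n m, IsAffine N → N ^ m = 0 →
    ∃ (K : Submodule ℂ (Fin n × Fin n → ℂ)) (k : ℕ),
      (∀ x v : Fin n × Fin n → ℂ, v ∈ K → ∀ i j : Fin m, (((N.map (lineSubst x v)) ^ (n - 1)) i j).totalDegree ≤ k) ∧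
      (k + 1) * n < Module.finrank ℂ K

/-! ## §2b (placed before the stubs since the S2 discharge) S2 from the landed Literature fact, BY NAME (val-idea-9 g3, 09:11Z; fact DISCHARGED p622922 09:53Z)
`Literature.LinearAlgebra.GutermanMeshulamSpiridonov2023_cor_1_6` (p619424 @eb90aa6b1e0b, port hand val-port-1 g1, lit VET g16;
typed OPEN — Cor. 1.6 of arXiv:2212.11193 is NOT proved in the tree, so `stub_gms` above keeps its `sorry`): the fact is
stated with the tree's permanental rank `BoraleviCarliniMichalekVentura2025.prk`; the two theorems below are the sorry-free
bookkeeping bridge to this line's `GMSBound` (embedding form of "prk ≤ k"), so that the line is conditional on the fact BY NAME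
(`dualUnipotentThreeHalves_of_fact`, end of file). -/

/-- `PermRankLE n k v` (all `(k+1) × (k+1)` subpermanents along injections vanish) ⇒ the tree's permanental rank of the
matrix `(v (i,j))` is `≤ k` — via `forall_rsubperm_eq_zero_iff_prk_lt` and `Matrix.subperm_eq_permanent_of_equiv`. -/
theorem prk_le_of_permRankLE {n k : ℕ} {v : Fin n × Fin n → ℂ} (h : PermRankLE n k v) :
    Literature.Computability.AlgebraicComplexity.BoraleviCarliniMichalekVentura2025.prk
      (Matrix.of fun i j : Fin n => v (i, j)) ≤ k := by
  classical
  set A : Matrix (Fin n) (Fin n) ℂ := Matrix.of fun i j : Fin n => v (i, j) with hA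
  have hlt : Literature.Computability.AlgebraicComplexity.BoraleviCarliniMichalekVentura2025.prk A < k + 1 := by
    rw [← Literature.Computability.AlgebraicComplexity.BoraleviCarliniMichalekVentura2025.forall_rsubperm_eq_zero_iff_prk_lt
      A (h := k + 1) (by omega)]
    intro Rw Cl hR hC
    have eR : Fin (k + 1) ≃ {j // j ∈ Rw} :=
      (Finset.equivFinOfCardEq hR).symm.trans (Equiv.subtypeEquivRight (fun _ => Iff.rfl))
    have eC : Fin (k + 1) ≃ {i // i ∈ Cl} :=
      (Finset.equivFinOfCardEq hC).symm.trans (Equiv.subtypeEquivRight (fun _ => Iff.rfl))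
    rw [Literature.Computability.AlgebraicComplexity.BoraleviCarliniMichalekVentura2025.rsubperm_eq_subperm,
      Matrix.subperm_eq_permanent_of_equiv A eC eR]
    let r : Fin (k + 1) ↪ Fin n := ⟨fun a => (eR a : Fin n), fun a b hab => eR.injective (Subtype.ext hab)⟩
    let c : Fin (k + 1) ↪ Fin n := ⟨fun a => (eC a : Fin n), fun a b hab => eC.injective (Subtype.ext hab)⟩
    have hmat : (Matrix.of fun a b => A (eR a : Fin n) (eC b : Fin n)) = Matrix.of fun i j => v (r i, c j) := by
      ext a b; simp [hA, r, c]
    rw [hmat]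
    exact h r c
  omega

/-- **S2 BY NAME**: the landed Literature fact (GMS 2023 Cor. 1.6 over `ℂ`, tree-`prk` form) implies this line's
`GMSBound` — transport along `LinearEquiv.curry` and `prk_le_of_permRankLE`. Sorry-free. -/
theorem gmsBound_of_fact (hF : Literature.LinearAlgebra.GutermanMeshulamSpiridonov2023_cor_1_6 ℂ) : GMSBound := by
  classical
  intro n k K hK
  let e : (Fin n × Fin n → ℂ) ≃ₗ[ℂ] Matrix (Fin n) (Fin n) ℂ :=
    (LinearEquiv.curry ℂ ℂ (Fin n) (Fin n)).trans (LinearEquiv.refl ℂ _)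
  have hW : ∀ A ∈ K.map (e : (Fin n × Fin n → ℂ) →ₗ[ℂ] Matrix (Fin n) (Fin n) ℂ),
      Literature.Computability.AlgebraicComplexity.BoraleviCarliniMichalekVentura2025.prk A ≤ k := by
    intro A hA
    obtain ⟨v, hv, rfl⟩ := Submodule.mem_map.1 hA
    have : (e : (Fin n × Fin n → ℂ) →ₗ[ℂ] _) v = Matrix.of fun i j : Fin n => v (i, j) := by
      ext i j; rfl
    rw [this]
    exact prk_le_of_permRankLE (hK v hv)
  have := hF n k (K.map (e : (Fin n × Fin n → ℂ) →ₗ[ℂ] Matrix (Fin n) (Fin n) ℂ)) hW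
  rwa [LinearEquiv.finrank_map_eq] at this

/-! ## Registered stubs -/

theorem stub_permRank_of_lineFlat : PermRankOfLineFlat := by
  -- LANDED (`…Theorems.GrenetZeonDualUnipotentThreeHalvesPermRankOfLineFlat`, `GrenetZeon.SlowPlanes.permRank_of_lineFlat`,
  -- S1 with LineFlat/lineSubst/PermRankLE unfolded verbatim): by-name citation, δ-unfold (port hand val-port-1 g1, val-lit RULING #254 (b)(iv)).
  exact Summit.ValiantsHypothesis.ValiantsHypothesis.Theorems.GrenetZeon.SlowPlanes.permRank_of_lineFlat
theorem stub_gms : GMSBound :=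
  -- S2 is a THEOREM by name: the Literature fact `Literature.LinearAlgebra.GutermanMeshulamSpiridonov2023_cor_1_6` was
  -- DISCHARGED (p622922 `Literature/LinearAlgebra/GMSPermanentalRankSubspaceHolds.lean :: …_cor_1_6_holds`, val-lit-p9 g1,
  -- [paper:arxiv-2212.11193 §2]) and §2b's sorry-free bridge `gmsBound_of_fact` converts it to this line's `GMSBound`.
  gmsBound_of_fact (Literature.LinearAlgebra.GutermanMeshulamSpiridonov2023_cor_1_6_holds ℂ)

theorem stub_slowPlane : SlowPlane := by
  sorry

/-! ## Composition (sorry-free) -/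

/-- Degree of the pulled-back trace product: entries of `N'^d` of degree `≤ k`, `M` affine ⇒ `≤ k + 1`. -/
theorem totalDegree_lineSubst_trace_le {n m d k : ℕ} (N M : AffMat n m) (hM : IsAffine M)
    (x v : Fin n × Fin n → ℂ)
    (hdeg : ∀ i j : Fin m, (((N.map (lineSubst x v)) ^ d) i j).totalDegree ≤ k) :
    (lineSubst x v ((N ^ d * M).trace)).totalDegree ≤ k + 1 := by
  set θ := lineSubst x v with hθ
  have hmap : θ ((N ^ d * M).trace) = ((N.map θ) ^ d * M.map θ).trace := by
    rw [show N.map θ = θ.toRingHom.mapMatrix N from rfl,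
      show M.map θ = θ.toRingHom.mapMatrix M from rfl, ← map_pow, ← map_mul]
    simp only [Matrix.trace, Matrix.diag_apply, map_sum, RingHom.mapMatrix_apply, Matrix.map_apply]
    rfl
  rw [hmap, Matrix.trace]
  simp only [Matrix.diag_apply, Matrix.mul_apply]
  have hbound : ∀ i j : Fin m, (((N.map θ) ^ d) i j * (M.map θ) j i).totalDegree ≤ k + 1 := by
    intro i j
    have h1 := hdeg i j
    have h2 : ((M.map θ) j i).totalDegree ≤ 1 := by
      rw [Matrix.map_apply]; exact totalDegree_lineSubst_le_one x v (hM j i)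
    have h3 := totalDegree_mul (((N.map θ) ^ d) i j) ((M.map θ) j i)
    omega
  refine (totalDegree_finsetSum _ _).trans (Finset.sup_le fun i _ => ?_)
  exact (totalDegree_finsetSum _ _).trans (Finset.sup_le fun j _ => hbound i j)

/-- **The line.**  S1 + S2 (per-specific: sharp flat profile) + S3 (per-agnostic: slow plane) ⇒ the 3/2 rung. -/
theorem dualUnipotentThreeHalves_of (h1 : PermRankOfLineFlat) (h2 : GMSBound) (h3 : SlowPlane) :
    DualUnipotentThreeHalves := by
  obtain ⟨C₀, n₀, hC⟩ := h3
  refine ⟨C₀, n₀ + 1, ?_⟩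
  intro n hn m hrep
  have hrep' : DualUnipotentRepr n m := hrep
  have hn1 : 1 ≤ n := by omega
  by_contra hlt
  have hlt' : C₀ * m ^ 2 < n ^ 3 := by omega
  obtain ⟨N, M, hN, hM, hnil, hper⟩ := exists_nilpotent_pencil_of_dualUnipotentRepr hn1 hrep'
  have haffN : IsAffine N := fun i j => (hN i j).totalDegree_le
  have haffM : IsAffine M := fun i j => (hM i j).totalDegree_le
  obtain ⟨K, k, hdeg, hdim⟩ := hC n (by omega) m hlt' N haffN hnil
  -- per_n is line-flat of order k+1 along K
  have hflat : LineFlat n (k + 1) K := by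
    intro x v hv
    rw [hper]
    exact totalDegree_lineSubst_trace_le N M haffM x v (hdeg x v hv)
  -- hence K consists of matrices of permanental rank ≤ k+1, hence dim K ≤ (k+1)·n
  have hrk := h1 n (k + 1) K hflat
  have hfin := h2 n (k + 1) K hrk
  omega

/-- The target through the registered stubs. -/
theorem dualUnipotentThreeHalves_via_stubs : DualUnipotentThreeHalves :=
  dualUnipotentThreeHalves_of stub_permRank_of_lineFlat stub_gms stub_slowPlane

/-- **The line, conditional on the Literature fact BY NAME** (S1 landed, S2 = GMS fact via `gmsBound_of_fact`):
`GMS Cor 1.6 (ℂ) → SlowPlane → DualUnipotentThreeHalves`, no `sorry` on this path. -/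
theorem dualUnipotentThreeHalves_of_fact
    (hF : Literature.LinearAlgebra.GutermanMeshulamSpiridonov2023_cor_1_6 ℂ) (h3 : SlowPlane) :
    DualUnipotentThreeHalves :=
  dualUnipotentThreeHalves_of stub_permRank_of_lineFlat (gmsBound_of_fact hF) h3

/-- **The line in the kernel, fact-free:** crux 24318 ⟸ `SlowPlane` ALONE (S1, S2 are theorems by name). -/
theorem dualUnipotentThreeHalves_of_law (h3 : SlowPlane) : DualUnipotentThreeHalves :=
  dualUnipotentThreeHalves_of stub_permRank_of_lineFlat stub_gms h3

end Summit.ValiantsHypothesis.ValiantsHypothesis.Cruxes.DualUnipotentThreeHalves.SlowPlanes
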